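import Summits.CriticalPhenomena.PercolationContinuityZ3.Theorems.Transplant.SubgraphLocModCycle
import HarnessLib

/-!
# Routes from cycle data, II: the column case and the assembly

builds on p205010 (kernel theorem, internal audit signed; external expert review pending) — nothing in this file uses p205010.
Lane `prim-bschramm`, seat `prim-bschramm-p4` gen 10 (PART C3, tier 2′ of `P4-GENERAL.md`).  Helper file
(`--supports stmt-CriticalPhenomena-4575 --as helper`).  Pure graph theory; sequel of `SubgraphLocModCycle`.

* `CycleKit.routeData_of_mem_A` — the route when the first cycle vertex `u` seen from the root lies on the column `A` of `x`
  (forward through the first enhancement edge of `M` to a target on `M ∪ B`; forward around the cycle through the closing edge to a target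
  on `A` below `u`; or backward through `B` and the last enhancement edge of `M` down `A` to a target above `u`);
* `CycleKit.exists_routeData` — all positions of `u` (column of `y` by mirroring);
* `CycleKit.exists_routeData_of_pivotal` — **for a pivotal subgraph edge `{x, y}` carrying a cycle kit whose columns are unions of
  classes of a class-saturated `Ω`, the local modification exists**: some `SubLoc.RouteData` for `ω ∖ {e}` at the zone of the kit whose
  enhancement edge lies in `E'` (then `RouteData.modify_not_mem` / `insert_mem` say that this edge is pivotal).
-/

namespace Summit.CriticalPhenomena.PercolationContinuityZ3.Theorems.Transplant

namespace SubLoc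

open SimpleGraph Walk

variable {V : Type} [DecidableEq V] {H : SimpleGraph V}

namespace CycleKit

variable {E' : Set (Sym2 V)} {x y : V} (K : CycleKit H E' x y)

/-- **Case `u ∈ A`.** [cite: BalisterBollobasRiordan2014, §"bond percolation" p. 13] -/
theorem routeData_of_mem_A {ωe : Set (Sym2 V)} {Ω : Set V} {o u v₀ : V}
    (huA : u ∈ K.A.support) (π : (og H ωe).Walk o u) (hπ : ∀ w ∈ π.support, w ∈ K.Z → w = u)
    (hv₀Z : v₀ ∈ K.Z) (hv₀u : v₀ ≠ u) (hv₀ : K.Exit ωe Ω v₀) (hAΩ : ∀ w ∈ K.A.support, w ∈ Ω) :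
    ∃ D : RouteData H ωe Ω K.Z o, s(D.a, D.b) ∈ E' := by
  -- the first edge of `M`
  obtain ⟨m₁, hpm, M', hM'⟩ := exists_eq_cons K.M K.hpq
  have hMp : M'.IsPath ∧ K.p ∉ M'.support := by
    have h := K.hM; rw [hM', cons_isPath_iff] at h; exact h
  have hM'sub : ∀ w ∈ M'.support, w ∈ K.M.support := fun w hw => by
    rw [hM', support_cons]; exact List.mem_cons_of_mem _ hw
  have hf : s(K.p, m₁) ∈ E' := K.hME _ (by rw [hM', edges_cons]; exact List.mem_cons_self)
  -- the forward walk `m₁ —M'→ q —B→ y` avoids `A`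
  set W : H.Walk m₁ y := M'.append K.B with hW
  have hWZ : ∀ w ∈ W.support, w ∈ K.Z := fun w hw => by
    rcases (mem_support_append_iff _ _).1 hw with hw | hw
    · exact Or.inr (Or.inl (hM'sub w hw))
    · exact Or.inr (Or.inr hw)
  have hWA : ∀ w ∈ W.support, w ∉ K.A.support := fun w hw hwA => by
    rcases (mem_support_append_iff _ _).1 hw with hw | hw
    · exact hMp.2 ((K.hAM w hwA (hM'sub w hw)) ▸ hw)
    · exact K.hAB w hwA hw
  have hR₁A : ∀ w ∈ (K.A.dropUntil u huA).support, w ∈ K.A.support := fun w hw => support_dropUntil_subset_support _ _ hw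
  by_cases hα : ∃ t ∈ W.support, t = v₀ ∨ t ∉ Ω
  · -- (α) forward to a target on `M' ∪ B`
    obtain ⟨t, htW, ht⟩ := hα
    refine ⟨⟨u, K.p, m₁, t, K.A.dropUntil u huA, hpm, W.takeUntil t htW, ?_, ?_, ?_, ?_, π, hπ, ?_⟩, hf⟩
    · exact fun w h1 h2 => hWA w (support_takeUntil_subset_support _ _ h2) (hR₁A w h1)
    · exact fun w hw => Or.inl (hR₁A w hw)
    · exact fun w hw => hWZ w (support_takeUntil_subset_support _ _ hw)
    · exact fun w hw => hAΩ w (hR₁A w hw)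
    · rcases ht with rfl | ht
      · exact hv₀
      · exact Or.inl ht
  · push Not at hα
    have hv₀W : v₀ ∉ W.support := fun h => (hα v₀ h).1 rfl
    have hv₀A : v₀ ∈ K.A.support := by
      rcases hv₀Z with h | h | h
      · exact h
      · rw [hM', support_cons, List.mem_cons] at h
        rcases h with h | h
        · exact h ▸ K.A.end_mem_support
        · exact absurd ((mem_support_append_iff _ _).2 (Or.inl h)) hv₀W
      · exact absurd ((mem_support_append_iff _ _).2 (Or.inr h)) hv₀W
    by_cases hv₀T : v₀ ∈ (K.A.takeUntil u huA).support
    · -- (β1) forward around the cycle, through the closing edge, up `A` to `v₀`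
      have huT : u ∉ (K.A.takeUntil v₀ hv₀A).support :=
        notMem_support_takeUntil_support_takeUntil_subset hv₀u huA hv₀T
      refine ⟨⟨u, K.p, m₁, v₀, K.A.dropUntil u huA, hpm,
        W.append (Walk.cons K.hyx (K.A.takeUntil v₀ hv₀A)), ?_, ?_, ?_, ?_, π, hπ, hv₀⟩, hf⟩
      · intro w h1 h2
        rcases (mem_support_append_iff _ _).1 h2 with h2 | h2
        · exact hWA w h2 (hR₁A w h1)
        · rw [support_cons, List.mem_cons] at h2
          rcases h2 with rfl | h2
          · exact K.hAB _ (hR₁A _ h1) K.B.end_mem_support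
          · exact takeUntil_dropUntil_disjoint K.hA hv₀A huA huT h2 h1
      · exact fun w hw => Or.inl (hR₁A w hw)
      · intro w hw
        rcases (mem_support_append_iff _ _).1 hw with hw | hw
        · exact hWZ w hw
        · rw [support_cons, List.mem_cons] at hw
          rcases hw with rfl | hw
          · exact K.y_mem_Z
          · exact Or.inl (support_takeUntil_subset_support _ _ hw)
      · exact fun w hw => hAΩ w (hR₁A w hw)
    · -- (β2) backward: down `A`, across the closing edge, up `B`, into `M` from `q`, and down `A` from `p` to `v₀`
      have hv₀D : v₀ ∈ (K.A.dropUntil u huA).support := (mem_takeUntil_or_dropUntil K.A huA hv₀A).resolve_left hv₀T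
      have hup : u ≠ K.p := by
        rintro rfl
        rcases mem_takeUntil_total K.A huA hv₀A with h | h
        · exact hv₀T h
        · exact end_not_mem_takeUntil K.hA hv₀A hv₀u h
      have hWΩ : ∀ w ∈ K.B.support, w ∈ Ω := fun w hw => (hα w ((mem_support_append_iff _ _).2 (Or.inr hw))).2
      obtain ⟨mk, hqm, M'', hM''⟩ := exists_eq_cons K.M.reverse K.hpq.symm
      have hMq : M''.IsPath ∧ K.q ∉ M''.support := by
        have h := K.hM.reverse; rw [hM'', cons_isPath_iff] at h; exact h
      have hM''sub : ∀ w ∈ M''.support, w ∈ K.M.support := fun w hw => by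
        have : w ∈ K.M.reverse.support := by rw [hM'', support_cons]; exact List.mem_cons_of_mem _ hw
        simpa using this
      have hf' : s(K.q, mk) ∈ E' := K.hME _ (by
        have : s(K.q, mk) ∈ K.M.reverse.edges := by rw [hM'', edges_cons]; exact List.mem_cons_self
        simpa using this)
      refine ⟨⟨u, K.q, mk, v₀, (K.A.takeUntil u huA).reverse.append (Walk.cons K.hyx.symm K.B.reverse), hqm,
        M''.append (K.A.dropUntil v₀ hv₀A).reverse, ?_, ?_, ?_, ?_, π, hπ, hv₀⟩, hf'⟩
      · intro w h1 h2
        rw [mem_support_append_iff, support_reverse, List.mem_reverse, support_cons, List.mem_cons, support_reverse,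
          List.mem_reverse] at h1
        rw [mem_support_append_iff, support_reverse, List.mem_reverse] at h2
        -- `w` is on `A` up to `u` (or is `x`), or on `B`; and on `M''` or on `A` from `v₀`
        have h1' : w ∈ (K.A.takeUntil u huA).support ∨ w ∈ K.B.support := by
          rcases h1 with h | rfl | h
          · exact Or.inl h
          · exact Or.inl (Walk.start_mem_support _)
          · exact Or.inr h
        rcases h1' with h1 | h1 <;> rcases h2 with h2 | h2
        · have hwp : w = K.p := K.hAM w (support_takeUntil_subset_support _ _ h1) (hM''sub w h2)
          subst hwp
          exact end_not_mem_takeUntil K.hA huA hup h1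
        · exact takeUntil_dropUntil_disjoint K.hA huA hv₀A hv₀T h1 h2
        · exact hMq.2 ((K.hMB w (hM''sub w h2) h1) ▸ h2)
        · exact K.hAB w (support_dropUntil_subset_support _ _ h2) h1
      · intro w hw
        rw [mem_support_append_iff, support_reverse, List.mem_reverse, support_cons, List.mem_cons, support_reverse,
          List.mem_reverse] at hw
        rcases hw with h | rfl | h
        · exact Or.inl (support_takeUntil_subset_support _ _ h)
        · exact K.x_mem_Z
        · exact Or.inr (Or.inr h)
      · intro w hw
        rw [mem_support_append_iff, support_reverse, List.mem_reverse] at hw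
        rcases hw with h | h
        · exact Or.inr (Or.inl (hM''sub w h))
        · exact Or.inl (support_dropUntil_subset_support _ _ h)
      · intro w hw
        rw [mem_support_append_iff, support_reverse, List.mem_reverse, support_cons, List.mem_cons, support_reverse,
          List.mem_reverse] at hw
        rcases hw with h | rfl | h
        · exact hAΩ w (support_takeUntil_subset_support _ _ h)
        · exact hAΩ _ (Walk.start_mem_support _)
        · exact hWΩ w h

/-- **Routes exist** for every position of the first cycle vertex seen from the root. [cite: BalisterBollobasRiordan2014, §"bond percolation" p. 13] -/
theorem exists_routeData {ωe : Set (Sym2 V)} {Ω : Set V} {o : V} (hωe : ωe ∉ exitEv H Ω o)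
    (hx : (og H ωe).Reachable o x) (hy : y ∉ Ω ∨ ∃ q', q' ∉ Ω ∧ (og H ωe).Reachable y q')
    (hAΩ : ∀ w ∈ K.A.support, w ∈ Ω) (hBΩ : (∀ w ∈ K.B.support, w ∈ Ω) ∨ (∀ w ∈ K.B.support, w ∉ Ω)) :
    ∃ D : RouteData H ωe Ω K.Z o, s(D.a, D.b) ∈ E' := by
  -- the first cycle vertex seen from the root
  obtain ⟨πx⟩ := hx
  obtain ⟨u, huZ, π, -, -, hπ⟩ := exists_first_hit πx K.Z K.x_mem_Z
  have huΩ : u ∈ Ω := mem_of_reachable_of_not_exit hωe π.reachable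
  -- the first cycle vertex seen from `F`
  obtain ⟨v₀, hv₀Z, hv₀, hv₀r⟩ : ∃ v₀, v₀ ∈ K.Z ∧ K.Exit ωe Ω v₀ ∧ ¬ (og H ωe).Reachable o v₀ := by
    rcases hy with hy | ⟨q', hq', ⟨ρ'⟩⟩
    · exact ⟨y, K.y_mem_Z, Or.inl hy, fun h => hy (mem_of_reachable_of_not_exit hωe h)⟩
    · obtain ⟨v₀, hv₀Z, ρ₀, -, -, hρ₀⟩ := exists_first_hit ρ'.reverse K.Z K.y_mem_Z
      refine ⟨v₀, hv₀Z, Or.inr ⟨q', hq', ρ₀.reverse, fun w hw hZ => hρ₀ w (by simpa using hw) hZ⟩, fun h => ?_⟩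
      exact hq' (mem_of_reachable_of_not_exit hωe (h.trans ρ₀.reachable.symm))
  have hv₀u : v₀ ≠ u := fun h => hv₀r (h ▸ π.reachable)
  by_cases huA : u ∈ K.A.support
  · exact K.routeData_of_mem_A huA π hπ hv₀Z hv₀u hv₀ hAΩ
  by_cases huB : u ∈ K.B.support
  · -- mirror: `u` lies on the column of `y`, which is then inside `Ω`
    have hBΩ' : ∀ w ∈ K.B.support, w ∈ Ω := hBΩ.elim id fun h => absurd huΩ (h u huB)
    have h := K.mirror.routeData_of_mem_A (ωe := ωe) (Ω := Ω) (o := o) (u := u) (v₀ := v₀) (by simpa [mirror] using huB) π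
      (fun w hw hZ => hπ w hw (by rwa [K.mirror_Z] at hZ)) (by rw [K.mirror_Z]; exact hv₀Z) hv₀u (K.mirror_exit hv₀)
      (fun w hw => hBΩ' w (by simpa [mirror] using hw))
    rwa [K.mirror_Z] at h
  · have huM : u ∈ K.M.support := by
      rcases huZ with h | h | h
      · exact absurd h huA
      · exact h
      · exact absurd h huB
    exact K.routeData_of_mem_M huM huA huB huΩ π hπ hv₀Z hv₀u hv₀

/-- **THE LOCAL MODIFICATION EXISTS at a pivotal subgraph edge carrying a cycle kit** whose two columns are each entirely inside or
entirely outside `Ω`: some route for `ω ∖ {e}` at the zone of the kit, with enhancement edge in `E'`.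
[cite: BalisterBollobasRiordan2014, §"bond percolation" p. 13] [cite: AizenmanGrimmett1991, §2 (essential enhancements)] -/
theorem exists_routeData_of_pivotal {Ω : Set V} {o : V} {ω : Set (Sym2 V)}
    (hin : insert s(x, y) ω ∈ exitEv H Ω o) (hout : ω \ {s(x, y)} ∉ exitEv H Ω o)
    (hAcl : (∀ w ∈ K.A.support, w ∈ Ω) ∨ (∀ w ∈ K.A.support, w ∉ Ω))
    (hBcl : (∀ w ∈ K.B.support, w ∈ Ω) ∨ (∀ w ∈ K.B.support, w ∉ Ω)) :
    ∃ D : RouteData H (ω \ {s(x, y)}) Ω K.Z o, s(D.a, D.b) ∈ E' := by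
  obtain ⟨x₀, y₀, he, -, hreach, hfar⟩ := exists_side_of_pivotal K.hyx.symm hin hout
  have hx₀Ω : x₀ ∈ Ω := mem_of_reachable_of_not_exit hout hreach
  rcases Sym2.eq_iff.1 he with ⟨rfl, rfl⟩ | ⟨rfl, rfl⟩
  · exact K.exists_routeData hout hreach hfar (hAcl.elim id fun h => absurd hx₀Ω (h _ K.A.start_mem_support)) hBcl
  · have hBΩ : ∀ w ∈ K.B.support, w ∈ Ω := hBcl.elim id fun h => absurd hx₀Ω (h _ K.B.end_mem_support)
    have h := K.mirror.exists_routeData hout hreach hfar (fun w hw => hBΩ w (by simpa [mirror] using hw))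
      (by simpa [mirror] using hAcl)
    rwa [K.mirror_Z] at h

end CycleKit

end SubLoc

end Summit.CriticalPhenomena.PercolationContinuityZ3.Theorems.Transplant
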